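import Literature.MathematicalPhysics.QuantumFieldTheory.Balaban1983to89.B2Ineq335Exceptions
import Literature.MathematicalPhysics.QuantumFieldTheory.Balaban1983to89.B2Sect3BSmallFactors

/-!
# `Balaban1983to89.B2Ineq335Printed` — [Balaban1982Higgs2] §3.B pp. 589–591, file 2/2 of «(3.22) ⇒ (3.35)»: the
Gaussian renormalization kernels WITH THE PRINTED LARGE-FIELD EXCEPTIONS ((3.32) + (3.33) for a whole level), the
pointwise step from Proposition 3.1 (3.26) via (3.30) and (3.31) level by level, and **(3.35) IN THE PRINTED LETTERS**
(`ineq335`) — both hypotheses of file 1/2's `B2Ineq335Exceptions.rhs322_le` DISCHARGED from the printed inputs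

statement-level skeleton of published theorems with citation tags; proofs where landed; nothing here is a claim about the Yang–Mills mass gap

CITATION HEADER.  T. Bałaban, *(Higgs)₂,₃ quantum fields in a finite volume. II. An upper bound*, Commun. Math. Phys.
**86** (1982) 555–594 [Balaban1982Higgs2] (cell paper B2; PDF held `paper:balaban1982-cmp86-higgs23-ii`, journal page =
PDF page + 554; pp. 589–591 READ AS IMAGES on the ×2 renders
`run/shared/lean/pub/pub-balaban/b2b-balaban-ref1/pages/1982-cmp86-higgs23-II/1982-cmp86-higgs23-II-p035-x2.png` … `-p037-x2.png`).
Unit `lit-balaban-p15` gen 6 (Phase-2 proof seat p15; HOME `run/shared/lean/pub/lit-balaban/`).  SKELETON row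
**B2.Eq3.32** residue member (3.35) (fold owner r02, second readers r14/r13, referee ref-4).  USED BY NAME: file 1/2
`B2Ineq335Exceptions.rhs322_le` (the integration-with-exceptions mechanism), r14 g5 `B2Eq337LastIntegrations.gaussLevel`
(the level kernels `Π_y t_{β}(φ_{j+1}(y) − c_{j,y})` over r14 g1's `B1RT.rtKernel`), r14 g3 `B2Sect3BSmallFactors.ineq330`
((3.30)), `ineq331` ((3.31)), `ineq333` ((3.33) at one site); `B1RT.integral_rtKernel_sub` ((3.32) = I (2.8) at one
site); Mathlib `integral_fintype_prod_volume_eq_prod` (Fubini over the sites of a level).  The source text of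
(3.30)–(3.35) is quoted verbatim in file 1/2; Prop. 3.1 (3.26) p. 589: *"⟨Φ, Δ(Ã^ε)Φ⟩ ≧ γ₀Σ_{k=0}^{K}Σ_{⟨x,x′⟩⊂Λ₅⁽ᵏ⁻¹⁾′∩Λ₅⁽ᵏ⁾ᶜ}
(Lᵏε)^{d−2}|U(Ã^ε(⟨x,x′⟩))φ_k(x′) − φ_k(x)|² + γ₀Σ_{k=0}^{K}Σ_{x∈Λ₅⁽ᵏ⁻¹⁾′∩Λ₅⁽ᵏ⁾ᶜ}(Lᵏε)^d m²|φ_k(x)|² − Σ_{k=1}^{K}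
O((Lᵏε)^{κ₀})|(Λ₅⁽ᵏ⁻¹⁾′∩Λ₅⁽ᵏ⁾ᶜ)₁| (3.26) … for arbitrary configurations Ã^ε, Φ … satisfying the restrictions given by
the characteristic functions in (3.21)"*.

DICTIONARY (abstract ↤ printed), continuing file 1/2 and `B2Sect3BSmallFactors`.  `V` ↤ ℝ^N, `S i` ↤ the sites
carrying the level-i variables (`S 0` ↤ the sites of Φ, `S (j+1)` ↤ `Λ₅⁽ʲ⁾ᶜ′`), `volume` on `S i → V`; precision of
the level-(j+1) kernel `a·s_j` ↤ `a(Lʲε)^{d−2}` (`= B1RT.prec a (Lʲε) d`); centre maps `c_j` ↤ `(Q(Ã^{(j)})φ_j)(y)`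
(reading the levels `≤ j`); threshold `r_j` ↤ `p(Lʲε)²`, the same number in (3.31) and (3.33); `largeFieldSite P s r
y` ↤ the indicator `χ({(Lʲε)^{d−2}|φ_{j+1}(y) − (Q(Ã^ε)φ_j)(y)|² > p(Lʲε)²})` at `y ∈ P = P_s⁽ʲ⁾`, `1` elsewhere; `Z ≥
0`, `X(Φ)` ↤ `Z(Ã^ε)`, `⟨Φ,Δ(Ã^ε)Φ⟩`; the k-th term of (3.26) `T_k = γ₀(Σ_{b∈Bk_k}t_{k,b}(Φ) + M_k(Φ)) − E_k` with bond
terms `t_{k,b} ≥ 0` (↤ `(Lᵏε)^{d−2}|U(Ã^ε(b))φ_k(b₊) − φ_k(b₋)|²` on the bonds `Bk_k` of `Λ_k`), mass part `M_k ≥ 0`,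
`E_k` ↤ `O((Lᵏε)^{κ₀})|Λ_k|` (in print `E₀ = 0`: *"The term for k = 0 already has the form required"*, p. 590);
`b(x) ∈ [0,1]` ↤ the product of the other characteristic functions, `h326` ↤ Prop. 3.1 holds on their support;
`χQ_{j,τ}(Φ) ∈ {0,1}` ↤ `χᶜ_{Q_s⁽ʲ⁾}`, `hlarge` ↤ its meaning (`= 1` forces `t_{j,b} > r_j` on `Q_s⁽ʲ⁾ ⊆ Bk_j`);
`w_{j,τ}` ↤ `χᶜ_{P_v}χᶜ_{Q_v}χᶜ_{R_v}exp(−p(Lʲε)²|R_s⁽ʲ⁾|)`; `4N log 2 ≤ a r_j` ↤ the tacit hypothesis of the second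
"≦" of (3.33) (`B2Sect3BSmallFactors.hyp333_of_b0`: automatic from `a b₀² ≥ 4N log 2`).

WHAT IS PROVED (kernel-checked, 0 `sorry`, standard axioms).
§1 `excLevel` (the exception factor `Π_y χ_y(φ_{j+1}(y) − c_{j,y})` of a level, one plumbing def; private
   measurability / locality lemmas for it and for r14's `gaussLevel`); **`lintegral_gaussLevel_mul_excLevel_le`** ((3.32) + (3.33) FOR A WHOLE LEVEL: site factors in `[0,1]` with one-site
   bounds `∫χ_y(φ−m)t_β(φ−m)dφ ≤ ϑ_y` for all centres ⇒ the level kernel times its exception factor has mass `≤ Π_yϑ_y`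
   for every history); the printed site factors `largeFieldSite` (def; values in `[0,1]`, measurable — private),
   **`integral_largeFieldSite_mul_rtKernel_le`** (`≤ e^{−⅛ar}` at `y ∈ P` by r14's `ineq333`, `= 1` elsewhere by (3.32)),
   **`lintegral_gaussLevel_mul_excLevel_printed_le`** (mass `≤ (e^{−⅛ar_j})^{|P|}`).
§2 **`prod_chi_mul_exp_le`** ((3.30)'s factor `e^{−¼ΣT_k}` against the `χᶜ_{Q_s⁽ʲ⁾}`: (3.31) level by level via r14's
   `ineq331`, the bare top level `e^{−¼T_K} ≤ e^{¼E_K}`), **`pointwise335`** (Prop. 3.1 on the support of `b`, (3.30) =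
   r14's `ineq330`, (3.31), `b ≤ 1` ⇒ the pointwise hypothesis of `rhs322_le` with `C = e^{¼Σ_{k≤K}E_k}`, `σ_{j,τ} =
   e^{−¼γ₀r_j|Q_s⁽ʲ⁾|}`).
§3 **`ineq335`**: for the schematic right side of (3.22) built from the Gaussian kernels of precision `a·s_j` and
   centres `c_j`, the weight `Z e^{−½X(Φ)}`, the other characteristic functions `b`, and the families
   `(w_{j,τ}, χQ_{j,τ}, P_{j,τ})`: `(3.22) ≤ e^{¼Σ_{k=0}^{K}E_k} · ∫dΦ Z e^{−¼X(Φ)} · Π_{j<K} Σ_τ w_{j,τ}·e^{−¼γ₀r_j|Q_{j,τ}|}·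
   (e^{−⅛ar_j})^{|P_{j,τ}|}` — (3.35) with the ζ′ of (3.34), from `h326`, `hlarge`, `4N log 2 ≤ a r_j` and the
   structural data alone (all measurability / locality / mass hypotheses of file 1/2 discharged).
HONEST SCOPE.  As file 1/2 (schematic levels; (3.21) → (3.22) and (3.40) not treated; the concrete `h335` of
`B2Ineq339Gathering` untouched).  Constants: the printed `exp Σ_{k=1}^{K}O((Lᵏε)^{κ₀})|Λ_k|` appears as `e^{¼Σ_{k=0}^{K}E_k}`
(`E₀ = 0` in print; the ¼ is the print's O(·)); `2^{N/2}e^{−¼ar} ≤ e^{−⅛ar}` needs `4N log 2 ≤ ar` exactly as in r14's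
(3.33).  Value = kernel certificate of the published step in schematic coordinates; NOT summit progress.
-/

noncomputable section

namespace Literature.MathematicalPhysics.QuantumFieldTheory.Balaban1983to89.B2Ineq335Printed

open MeasureTheory Finset Function
open scoped ENNReal
open B2Eq337LastIntegrations (chainDensity gaussLevel)
open B2Ineq335Exceptions

/-! ## §1  The Gaussian level kernels with LARGE-FIELD EXCEPTION FACTORS: (3.32) + (3.33) for a whole level -/

section Gaussian

variable {V : Type*} [NormedAddCommGroup V] [InnerProductSpace ℝ V] [FiniteDimensional ℝ V]
  [MeasurableSpace V] [BorelSpace V]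
variable {S : ℕ → Type*} [∀ j, Fintype (S j)]

/-- **THE EXCEPTION FACTOR OF LEVEL j+1**: `Π_{y ∈ S_{j+1}} χ_y(φ_{j+1}(y) − c_{j,y}(φ₀,…,φ_j))` — a product of
site factors evaluated, like the kernel `gaussLevel`, at the fluctuation `φ_{j+1}(y) − c_{j,y}` (↤ `χ_y` = the
indicator `χ({(Lʲε)^{d−2}|φ_{j+1}(y) − (Q(Ã^ε)φ_j)(y)|² > p(Lʲε)²})` at the exceptional sites `y ∈ P_s⁽ʲ⁾`, `χ_y = 1`
at the other sites: `largeFieldSite`), as an `[0,∞]`-valued density. [cite: Balaban1982Higgs2, (3.33) p.590, dictionary] -/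
def excLevel (c : (j : ℕ) → ((i : ℕ) → S i → V) → S (j + 1) → V) (j : ℕ) (χ : S (j + 1) → V → ℝ)
    (x : (i : ℕ) → S i → V) : ℝ≥0∞ :=
  ENNReal.ofReal (∏ y : S (j + 1), χ y (x (j + 1) y - c j x y))

variable {β : (j : ℕ) → S (j + 1) → ℝ} {c : (j : ℕ) → ((i : ℕ) → S i → V) → S (j + 1) → V}

/-- measurability of the exception factors (measurable site factors, measurable centre maps). [folklore] -/
private theorem measurable_excLevel (hc : ∀ j, Measurable (c j)) (j : ℕ) {χ : S (j + 1) → V → ℝ}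
    (hχ : ∀ y, Measurable (χ y)) : Measurable (excLevel c j χ) := by
  unfold excLevel
  refine ENNReal.measurable_ofReal.comp (Finset.measurable_prod _ fun y _ => ?_)
  exact (hχ y).comp
    (((measurable_pi_apply y).comp (measurable_pi_apply (j + 1))).sub ((measurable_pi_apply y).comp (hc j)))

/-- measurability of r14's Gaussian level kernels (the corresponding lemma of `B2Eq337LastIntegrations` is
private). [folklore] -/
private theorem measurable_gaussLevel (hc : ∀ j, Measurable (c j)) (j : ℕ) : Measurable (gaussLevel β c j) := by
  unfold gaussLevel
  refine ENNReal.measurable_ofReal.comp (Finset.measurable_prod _ fun y _ => ?_)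
  exact (B1RT.continuous_rtKernel (β j y)).measurable.comp
    (((measurable_pi_apply y).comp (measurable_pi_apply (j + 1))).sub ((measurable_pi_apply y).comp (hc j)))

omit [InnerProductSpace ℝ V] [FiniteDimensional ℝ V] [MeasurableSpace V] [BorelSpace V] in
/-- the exception factor of level j+1 does not read the levels above j+1 (centre maps reading the levels ≤ j).
[folklore] -/
private theorem excLevel_update_of_lt
    (hcdep : ∀ j i, j + 1 ≤ i → ∀ (x : (i : ℕ) → S i → V) (y : S i → V), c j (update x i y) = c j x)
    (j : ℕ) (χ : S (j + 1) → V → ℝ) (i : ℕ) (hji : j + 1 < i) (x : (i : ℕ) → S i → V) (y : S i → V) :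
    excLevel c j χ (update x i y) = excLevel c j χ x := by
  unfold excLevel
  rw [Function.update_of_ne (by omega : j + 1 ≠ i), hcdep j i hji.le x y]

omit [FiniteDimensional ℝ V] [MeasurableSpace V] [BorelSpace V] in
/-- r14's Gaussian level kernel does not read the levels above j+1. [folklore] -/
private theorem gaussLevel_update_of_lt
    (hcdep : ∀ j i, j + 1 ≤ i → ∀ (x : (i : ℕ) → S i → V) (y : S i → V), c j (update x i y) = c j x)
    (j i : ℕ) (hji : j + 1 < i) (x : (i : ℕ) → S i → V) (y : S i → V) :
    gaussLevel β c j (update x i y) = gaussLevel β c j x := by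
  unfold gaussLevel
  rw [Function.update_of_ne (by omega : j + 1 ≠ i), hcdep j i hji.le x y]

/-- **(3.32) + (3.33) FOR A WHOLE LEVEL**: if every site factor `χ_y` takes values in `[0,1]` and the one-site
integrals obey `∫dφ χ_y(φ − m)·t_{β_{j,y}}(φ − m) ≤ ϑ_y` for every centre `m` (↤ `ϑ = 1` by (3.32) at the ordinary
sites, `ϑ = e^{−⅛ap(Lʲε)²}` by (3.33) at the exceptional sites), then the level-(j+1) kernel WITH its exception
factor has mass `≤ Π_y ϑ_y` in `φ_{j+1}` for EVERY history (site-by-site Fubini,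
`integral_fintype_prod_volume_eq_prod`). [cite: Balaban1982Higgs2, (3.32)–(3.33) p.590] -/
theorem lintegral_gaussLevel_mul_excLevel_le (hβ : ∀ j y, 0 < β j y)
    (hcdep : ∀ j i, j + 1 ≤ i → ∀ (x : (i : ℕ) → S i → V) (y : S i → V), c j (update x i y) = c j x)
    (j : ℕ) {χ : S (j + 1) → V → ℝ} (hχm : ∀ y, Measurable (χ y)) (hχ0 : ∀ y v, 0 ≤ χ y v)
    (hχ1 : ∀ y v, χ y v ≤ 1) {ϑ : S (j + 1) → ℝ}
    (hϑ : ∀ y (m : V), ∫ φ, χ y (φ - m) * B1RT.rtKernel (β j y) (φ - m) ≤ ϑ y)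
    (x : (i : ℕ) → S i → V) :
    ∫⁻ ψ, gaussLevel β c j (update x (j + 1) ψ) * excLevel c j χ (update x (j + 1) ψ)
      ≤ ENNReal.ofReal (∏ y, ϑ y) := by
  unfold gaussLevel excLevel
  simp_rw [Function.update_self, hcdep j (j + 1) le_rfl x]
  have hnnK : ∀ ψ : S (j + 1) → V, 0 ≤ ∏ y, B1RT.rtKernel (β j y) (ψ y - c j x y) :=
    fun ψ => Finset.prod_nonneg fun y _ => B1RT.rtKernel_nonneg (hβ j y).le _
  simp_rw [← ENNReal.ofReal_mul (hnnK _), ← Finset.prod_mul_distrib]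
  -- the one-site factors
  set f : S (j + 1) → V → ℝ := fun y v => B1RT.rtKernel (β j y) (v - c j x y) * χ y (v - c j x y)
    with hf
  have hf0 : ∀ y v, 0 ≤ f y v :=
    fun y v => mul_nonneg (B1RT.rtKernel_nonneg (hβ j y).le _) (hχ0 _ _)
  have hint_y : ∀ y, Integrable (f y) := by
    intro y
    refine (B1RT.integrable_rtKernel_sub (hβ j y) (c j x y)).mono' ?_ (ae_of_all _ fun v => ?_)
    · exact (((B1RT.continuous_rtKernel _).measurable.comp (measurable_id.sub_const _)).mul
        ((hχm y).comp (measurable_id.sub_const _))).aestronglyMeasurable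
    · rw [Real.norm_eq_abs, abs_of_nonneg (hf0 y v)]
      exact mul_le_of_le_one_right (B1RT.rtKernel_nonneg (hβ j y).le _) (hχ1 _ _)
  have hint : Integrable (fun ψ : S (j + 1) → V => ∏ y, f y (ψ y)) := Integrable.fintype_prod hint_y
  have hnn : 0 ≤ᵐ[volume] fun ψ : S (j + 1) → V => ∏ y, f y (ψ y) :=
    ae_of_all _ fun ψ => Finset.prod_nonneg fun y _ => hf0 y (ψ y)
  change ∫⁻ ψ : S (j + 1) → V, ENNReal.ofReal (∏ y, f y (ψ y)) ≤ _
  rw [← ofReal_integral_eq_lintegral_ofReal hint hnn]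
  refine ENNReal.ofReal_le_ofReal ?_
  rw [integral_fintype_prod_volume_eq_prod (𝕜 := ℝ) f]
  refine Finset.prod_le_prod (fun y _ => integral_nonneg fun v => hf0 y v) fun y _ => ?_
  have h := hϑ y (c j x y)
  simp only [hf]
  simpa only [mul_comm] using h

/-- The printed exception factor: at the sites of `P` the large-field indicator `χ({s‖v‖² > r})` (↤ `s =
(Lʲε)^{d−2}`, `r = p(Lʲε)²`), elsewhere `1`. [cite: Balaban1982Higgs2, (3.33) p.590] -/
def largeFieldSite {T : Type*} [DecidableEq T] (P : Finset T) (s r : ℝ) (y : T) (v : V) : ℝ :=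
  if y ∈ P then (if r < s * ‖v‖ ^ 2 then 1 else 0) else 1

omit [InnerProductSpace ℝ V] [FiniteDimensional ℝ V] [BorelSpace V] in
/-- measurability of the printed site factors. [folklore] -/
private theorem measurable_largeFieldSite [OpensMeasurableSpace V] {T : Type*} [DecidableEq T] (P : Finset T)
    (s r : ℝ) (y : T) :
    Measurable (largeFieldSite (V := V) P s r y) := by
  unfold largeFieldSite
  by_cases hy : y ∈ P
  · simp only [hy, if_true]
    refine Measurable.ite ?_ measurable_const measurable_const
    exact measurableSet_lt measurable_const (measurable_const.mul (continuous_norm.measurable.pow_const 2))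
  · simp only [hy, if_false]
    exact measurable_const

omit [InnerProductSpace ℝ V] [FiniteDimensional ℝ V] [MeasurableSpace V] [BorelSpace V] in
/-- the printed site factors take values in `[0,1]`. [folklore] -/
private theorem largeFieldSite_mem {T : Type*} [DecidableEq T] (P : Finset T) (s r : ℝ) (y : T) (v : V) :
    0 ≤ largeFieldSite P s r y v ∧ largeFieldSite P s r y v ≤ 1 := by
  unfold largeFieldSite
  split_ifs <;> norm_num

/-- **(3.32)/(3.33) AT ONE SITE, printed coordinates**: for precision `a·s` (`a, s > 0`) and a threshold `r` with
`4N log 2 ≤ a r`, the one-site integral of the printed site factor against the kernel is `≤ e^{−⅛ar}` at an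
exceptional site (r14's `B2Sect3BSmallFactors.ineq333`) and `= 1 ≤ 1` at an ordinary one ((3.32) =
`B1RT.integral_rtKernel_sub`). [cite: Balaban1982Higgs2, (3.32)–(3.33) p.590] -/
theorem integral_largeFieldSite_mul_rtKernel_le {T : Type*} [DecidableEq T] (P : Finset T) {a s r : ℝ}
    (ha : 0 < a)
    (hs : 0 < s) (hr : 4 * (Module.finrank ℝ V : ℝ) * Real.log 2 ≤ a * r) (y : T) (m : V) :
    ∫ φ : V, largeFieldSite P s r y (φ - m) * B1RT.rtKernel (a * s) (φ - m)
      ≤ if y ∈ P then Real.exp (-(a * r / 8)) else 1 := by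
  unfold largeFieldSite
  by_cases hy : y ∈ P
  · simp only [hy, if_true]
    exact B2Sect3BSmallFactors.ineq333 ha hs hr m
  · simp only [hy, if_false, one_mul]
    exact (B1RT.integral_rtKernel_sub (mul_pos ha hs) m).le

omit [FiniteDimensional ℝ V] [MeasurableSpace V] [BorelSpace V] [∀ j, Fintype (S j)] in
/-- the product of the printed one-site bounds over a level: `Π_y (if y ∈ P then e^{−⅛ar} else 1) =
(e^{−⅛ar})^{|P|}`. [cite: Balaban1982Higgs2, (3.33)–(3.34) pp.590–591] -/
private theorem prod_ite_mem_eq_pow {T : Type*} [Fintype T] [DecidableEq T] (P : Finset T) (θ : ℝ) :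
    (∏ y : T, if y ∈ P then θ else 1) = θ ^ P.card := by
  rw [Finset.prod_ite_mem, Finset.univ_inter, Finset.prod_const]

end Gaussian

/-! ## §2  The pointwise step: Prop. 3.1 (3.26) via (3.30), then (3.31) level by level -/

section Pointwise

/-- **(3.30) + (3.31) MULTIPLIED OVER THE LEVELS**, in reals: with the k-th term of the right side of (3.26)
`T_k = γ₀(Σ_{b∈Bk_k} t_{k,b} + M_k) − E_k` (bond terms `t ≥ 0`, mass part `M ≥ 0`, error `E_k ≥ 0` — in print
`E₀ = 0`, the k = 0 term *"already has the form required"*), the values `χ_j ∈ {0,1}` of `χᶜ_{Q_s⁽ʲ⁾}` (`= 1`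
forces `t_{j,b} > r_j` on `Q_s⁽ʲ⁾ ⊆ Bk_j`) for the levels `j < K` carrying a family, and the bare factor
`e^{−¼T_K} ≤ e^{¼E_K}` at the top level: `(Π_{j<K} χ_j)·exp(−¼Σ_{k=0}^{K}T_k) ≤ (Π_{j<K} e^{−¼γ₀r_j|Q_s⁽ʲ⁾|})·
exp(¼Σ_{k=0}^{K}E_k)` (r14's `B2Sect3BSmallFactors.ineq331` level by level). [cite: Balaban1982Higgs2, (3.26) p.589, (3.30)–(3.31) p.590] -/
theorem prod_chi_mul_exp_le {Bnd : Type*} {K : ℕ} (Bk : ℕ → Finset Bnd) (t : ℕ → Bnd → ℝ)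
    (ht : ∀ j, ∀ b ∈ Bk j, 0 ≤ t j b) {M : ℕ → ℝ} (E : ℕ → ℝ) (hM : ∀ j, 0 ≤ M j)
    {γ₀ : ℝ} (hγ : 0 ≤ γ₀) (r : ℕ → ℝ) (Q : Fin K → Finset Bnd) (hQ : ∀ j, Q j ⊆ Bk j)
    (χ : Fin K → ℝ) (hχ : ∀ j, χ j = 0 ∨ χ j = 1) (hlarge : ∀ j, χ j = 1 → ∀ b ∈ Q j, r j < t j b) :
    (∏ j : Fin K, χ j) * Real.exp (-((∑ j ∈ range (K + 1), (γ₀ * (∑ b ∈ Bk j, t j b + M j) - E j)) / 4))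
      ≤ (∏ j : Fin K, Real.exp (-(γ₀ * r j * (Q j).card / 4)))
          * Real.exp ((∑ j ∈ range (K + 1), E j) / 4) := by
  set T : ℕ → ℝ := fun j => γ₀ * (∑ b ∈ Bk j, t j b + M j) - E j with hT
  have hsplit : Real.exp (-((∑ j ∈ range (K + 1), T j) / 4))
      = (∏ j : Fin K, Real.exp (-(T j / 4))) * Real.exp (-(T K / 4)) := by
    have : -((∑ j ∈ range (K + 1), T j) / 4) = ∑ j ∈ range (K + 1), (-(T j / 4)) := by
      rw [Finset.sum_div, ← Finset.sum_neg_distrib]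
    rw [this, Real.exp_sum, Finset.prod_range_succ,
      ← Fin.prod_univ_eq_prod_range (fun j => Real.exp (-(T j / 4))) K]
  change (∏ j : Fin K, χ j) * Real.exp (-((∑ j ∈ range (K + 1), T j) / 4)) ≤ _
  rw [hsplit, ← mul_assoc, ← Finset.prod_mul_distrib]
  -- level j < K: (3.31)
  have hj : ∀ j : Fin K, χ j * Real.exp (-(T j / 4))
      ≤ Real.exp (-(γ₀ * r j * (Q j).card / 4)) * Real.exp (E j / 4) := by
    intro j
    rw [← Real.exp_add]
    exact B2Sect3BSmallFactors.ineq331 (Bk j) (Q j) (hQ j) (t j) (ht j) hγ (hM j) (hχ j) (hlarge j)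
  -- level K: no family, e^{-T_K/4} ≤ e^{E_K/4}
  have hK : Real.exp (-(T K / 4)) ≤ Real.exp (E K / 4) := by
    refine Real.exp_le_exp.2 ?_
    have : 0 ≤ γ₀ * (∑ b ∈ Bk K, t K b + M K) :=
      mul_nonneg hγ (add_nonneg (Finset.sum_nonneg (ht K)) (hM K))
    simp only [hT]
    linarith
  have hχ0 : ∀ j, 0 ≤ χ j := fun j => by rcases hχ j with h | h <;> norm_num [h]
  calc (∏ j : Fin K, χ j * Real.exp (-(T j / 4))) * Real.exp (-(T K / 4))
      ≤ (∏ j : Fin K, Real.exp (-(γ₀ * r j * (Q j).card / 4)) * Real.exp (E j / 4))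
          * Real.exp (E K / 4) :=
        mul_le_mul (Finset.prod_le_prod (fun j _ => mul_nonneg (hχ0 j) (Real.exp_pos _).le) fun j _ => hj j)
          hK (Real.exp_pos _).le (Finset.prod_nonneg fun j _ => by positivity)
    _ = (∏ j : Fin K, Real.exp (-(γ₀ * r j * (Q j).card / 4)))
          * Real.exp ((∑ j ∈ range (K + 1), E j) / 4) := by
        rw [Finset.prod_mul_distrib, mul_assoc]
        congr 1
        rw [Finset.sum_div, Finset.sum_range_succ, Real.exp_add, Real.exp_sum,
          ← Fin.prod_univ_eq_prod_range (fun j => Real.exp (E j / 4)) K]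

/-- **THE POINTWISE STEP OF (3.35)** in the shape consumed by `rhs322_le`: Prop. 3.1 (3.26) `⟨Φ,Δ(Ã^ε)Φ⟩ = X ≥
Σ_{k=0}^{K}T_k` on the support of the characteristic functions (`b ≠ 0`, `b ∈ [0,1]` their product), (3.30)
`Z e^{−½X} ≤ Z e^{−¼X}e^{−¼ΣT_k}` (r14's `ineq330`), (3.31) level by level (`prod_chi_mul_exp_le`), and *"we
estimate the characteristic functions by 1"*: `Z e^{−½X}·b·Π_jχᶜ_{Q_s⁽ʲ⁾} ≤ e^{¼ΣE_k}·Z e^{−¼X}·Π_j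
e^{−¼γ₀r_j|Q_s⁽ʲ⁾|}` (as `[0,∞]`-valued densities). [cite: Balaban1982Higgs2, (3.26) p.589, (3.30)–(3.31) p.590] -/
theorem pointwise335 {Bnd : Type*} {K : ℕ} (Bk : ℕ → Finset Bnd) (t : ℕ → Bnd → ℝ)
    (ht : ∀ j, ∀ b ∈ Bk j, 0 ≤ t j b) {M : ℕ → ℝ} (E : ℕ → ℝ) (hM : ∀ j, 0 ≤ M j)
    {γ₀ : ℝ} (hγ : 0 ≤ γ₀) (r : ℕ → ℝ) (Q : Fin K → Finset Bnd) (hQ : ∀ j, Q j ⊆ Bk j)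
    (χ : Fin K → ℝ) (hχ : ∀ j, χ j = 0 ∨ χ j = 1) (hlarge : ∀ j, χ j = 1 → ∀ b ∈ Q j, r j < t j b)
    {Z X b : ℝ} (hZ : 0 ≤ Z) (hb : 0 ≤ b ∧ b ≤ 1)
    (h326 : b ≠ 0 → (∑ j ∈ range (K + 1), (γ₀ * (∑ bb ∈ Bk j, t j bb + M j) - E j)) ≤ X) :
    ENNReal.ofReal (Z * Real.exp (-(X / 2))) * ENNReal.ofReal b * ∏ j : Fin K, ENNReal.ofReal (χ j)
      ≤ ENNReal.ofReal (Real.exp ((∑ j ∈ range (K + 1), E j) / 4)) * ENNReal.ofReal (Z * Real.exp (-(X / 4)))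
        * ∏ j : Fin K, ENNReal.ofReal (Real.exp (-(γ₀ * r j * (Q j).card / 4))) := by
  by_cases hb0 : b = 0
  · rw [hb0, ENNReal.ofReal_zero, mul_zero, zero_mul]
    exact bot_le
  have hR := h326 hb0
  have hχ0 : ∀ j, 0 ≤ χ j := fun j => by rcases hχ j with h | h <;> norm_num [h]
  -- drop b ≤ 1
  have hb1 : ENNReal.ofReal b ≤ 1 := ENNReal.ofReal_le_one.2 hb.2
  calc ENNReal.ofReal (Z * Real.exp (-(X / 2))) * ENNReal.ofReal b * ∏ j : Fin K, ENNReal.ofReal (χ j)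
      ≤ ENNReal.ofReal (Z * Real.exp (-(X / 2))) * 1 * ∏ j : Fin K, ENNReal.ofReal (χ j) :=
        mul_le_mul' (mul_le_mul' le_rfl hb1) le_rfl
    _ = ENNReal.ofReal (Z * Real.exp (-(X / 2)) * ∏ j : Fin K, χ j) := by
        rw [mul_one, ENNReal.ofReal_mul (mul_nonneg hZ (Real.exp_pos _).le),
          ENNReal.ofReal_prod_of_nonneg fun j _ => hχ0 j]
    _ ≤ ENNReal.ofReal (Real.exp ((∑ j ∈ range (K + 1), E j) / 4) * (Z * Real.exp (-(X / 4)))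
          * ∏ j : Fin K, Real.exp (-(γ₀ * r j * (Q j).card / 4))) := by
        refine ENNReal.ofReal_le_ofReal ?_
        -- (3.30) then (3.31)
        have h330 := B2Sect3BSmallFactors.ineq330 hZ hR
        have h331 := prod_chi_mul_exp_le Bk t ht E hM hγ r Q hQ χ hχ hlarge
        have hP0 : 0 ≤ ∏ j : Fin K, χ j := Finset.prod_nonneg fun j _ => hχ0 j
        calc Z * Real.exp (-(X / 2)) * ∏ j : Fin K, χ j
            ≤ (Z * Real.exp (-(X / 4))
                * Real.exp (-((∑ j ∈ range (K + 1), (γ₀ * (∑ bb ∈ Bk j, t j bb + M j) - E j)) / 4)))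
                * ∏ j : Fin K, χ j := mul_le_mul_of_nonneg_right h330 hP0
          _ = (Z * Real.exp (-(X / 4))) * ((∏ j : Fin K, χ j)
                * Real.exp (-((∑ j ∈ range (K + 1), (γ₀ * (∑ bb ∈ Bk j, t j bb + M j) - E j)) / 4))) := by
              ring
          _ ≤ (Z * Real.exp (-(X / 4))) * ((∏ j : Fin K, Real.exp (-(γ₀ * r j * (Q j).card / 4)))
                * Real.exp ((∑ j ∈ range (K + 1), E j) / 4)) :=
              mul_le_mul_of_nonneg_left h331 (mul_nonneg hZ (Real.exp_pos _).le)
          _ = _ := by ring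
    _ = _ := by
        rw [ENNReal.ofReal_mul (mul_nonneg (Real.exp_pos _).le (mul_nonneg hZ (Real.exp_pos _).le)),
          ENNReal.ofReal_mul (Real.exp_pos _).le,
          ENNReal.ofReal_prod_of_nonneg fun j _ => (Real.exp_pos _).le]

end Pointwise

/-! ## §3  (3.35) FOR THE GAUSSIAN RENORMALIZATION KERNELS with the printed exceptions -/

section Printed

variable {V : Type*} [NormedAddCommGroup V] [InnerProductSpace ℝ V] [FiniteDimensional ℝ V]
  [MeasurableSpace V] [BorelSpace V]
variable {S : ℕ → Type*} [∀ j, Fintype (S j)] [∀ j, DecidableEq (S j)]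
variable {K : ℕ} {ι : Fin K → Type*} [∀ j, Fintype (ι j)]

/-- **THE EXCEPTIONAL MASS OF A LEVEL** (= (3.32) at the ordinary sites, (3.33) at the sites of `P`): the Gaussian
level kernel of precision `a·s_j` (↤ `a(Lʲε)^{d−2}`) times the printed exception factor of the site set `P ⊆
S_{j+1}` with threshold `r_j` (↤ `p(Lʲε)²`, `4N log 2 ≤ a r_j`) has mass `≤ (e^{−⅛ar_j})^{|P|}` in `φ_{j+1}` for every
history. [cite: Balaban1982Higgs2, (3.32)–(3.33) p.590] -/
theorem lintegral_gaussLevel_mul_excLevel_printed_le {a : ℝ} (ha : 0 < a) {s : ℕ → ℝ} (hs : ∀ j, 0 < s j)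
    {c : (j : ℕ) → ((i : ℕ) → S i → V) → S (j + 1) → V}
    (hcdep : ∀ j i, j + 1 ≤ i → ∀ (x : (i : ℕ) → S i → V) (y : S i → V), c j (update x i y) = c j x)
    {r : ℕ → ℝ} (hr : ∀ j, 4 * (Module.finrank ℝ V : ℝ) * Real.log 2 ≤ a * r j) (j : ℕ)
    (P : Finset (S (j + 1))) (x : (i : ℕ) → S i → V) :
    ∫⁻ ψ, gaussLevel (fun j _ => a * s j) c j (update x (j + 1) ψ)
        * excLevel c j (largeFieldSite P (s j) (r j)) (update x (j + 1) ψ)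
      ≤ ENNReal.ofReal (Real.exp (-(a * r j / 8)) ^ P.card) := by
  rw [← prod_ite_mem_eq_pow P]
  exact lintegral_gaussLevel_mul_excLevel_le (β := fun j _ => a * s j) (fun j _ => mul_pos ha (hs j)) hcdep j
    (fun y => measurable_largeFieldSite P (s j) (r j) y) (fun y v => (largeFieldSite_mem P (s j) (r j) y v).1)
    (fun y v => (largeFieldSite_mem P (s j) (r j) y v).2)
    (fun y m => integral_largeFieldSite_mul_rtKernel_le P ha (hs j) (hr j) y m) x

/-- **(3.35)** p. 591 *"we get the inequality (the right side of (3.22)) ≦ ∫dΦ Z(Ã^ε)·exp(−¼⟨Φ, Δ(Ã^ε)Φ⟩)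
Π_{k=0}^{K−1} ζ′_{Λ₀⁽ᵏ⁾} · exp Σ_{k=1}^{K} O((Lᵏε)^{κ₀})|Λ_k|. (3.35)"* with (3.34) *"ζ′_{Λ₀⁽ᵏ⁾} = Σ_{{P_v⁽ᵏ⁾,…,R_s⁽ᵏ⁾}
admissible, minimal} χᶜ_{P_v⁽ᵏ⁾}·χᶜ_{Q_v⁽ᵏ⁾}χᶜ_{R_v⁽ᵏ⁾} exp(−⅛ap(Lᵏε)²|P_s⁽ᵏ⁾|)·exp(−¼γ₀p(Lᵏε)²|Q_s⁽ᵏ⁾|)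
exp(−p(Lᵏε)²|R_s⁽ᵏ⁾|)"* — PROVED for the schematic right side of (3.22) (`rhs322`: the kept variables `Φ = x₀`,
the output fields `φ_{j+1}↾_{Λ₅⁽ʲ⁾ᶜ′} = x_{j+1}` produced by r14's Gaussian renormalization kernels `gaussLevel` of
precision `a(Lʲε)^{d−2} = a·s_j` with history-dependent centres `c_j` (↤ `Q(Ã^{(j)})φ_j`), the weight
`Z(Ã^ε)e^{−½X(Φ)}` (↤ (3.25)), the other characteristic functions `b ∈ [0,1]`, and the functions `ζ_{Λ₀⁽ʲ⁾} =
Σ_τ w_{j,τ}·χᶜ_{Q_s⁽ʲ⁾(τ)}(Φ)·χᶜ_{P_s⁽ʲ⁾(τ)}(φ_{j+1} − c_j)`), from the PRINTED INPUTS: Prop. 3.1 (3.26) on the support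
of the characteristic functions (`h326`; terms `T_k = γ₀(Σ_b t_{k,b} + M_k) − E_k`, `E_k ≥ 0` the
`O((Lᵏε)^{κ₀})|Λ_k|`, in print `E₀ = 0`), the meaning of `χᶜ_{Q_s⁽ʲ⁾}` (`hlarge`: `= 1` forces `t_{j,b} > r_j =
p(Lʲε)²` on `Q_s⁽ʲ⁾ ⊆` the bonds of `Λ_j`), and `4N log 2 ≤ a r_j` (the tacit hypothesis of (3.33), r14's
`hyp333_of_b0`).  Conclusion: `(3.22) ≤ e^{¼ΣE_k} · ∫dΦ Z(Ã^ε)e^{−¼X(Φ)} · Π_{j<K} Σ_τ w_{j,τ}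
e^{−¼γ₀r_j|Q_s⁽ʲ⁾(τ)|}(e^{−⅛ar_j})^{|P_s⁽ʲ⁾(τ)|}` — (3.35) with the ζ′ of (3.34) (the factors `χᶜ_{P_v}χᶜ_{Q_v}χᶜ_{R_v}
exp(−p²|R_s|)`, constant in the scalar fields, are the weights `w`) and the printed `exp ΣO(·)` as `e^{¼ΣE_k}`.
[cite: Balaban1982Higgs2, (3.34)–(3.35) p.591] -/
theorem ineq335 {a : ℝ} (ha : 0 < a) {s : ℕ → ℝ} (hs : ∀ j, 0 < s j)
    {c : (j : ℕ) → ((i : ℕ) → S i → V) → S (j + 1) → V} (hc : ∀ j, Measurable (c j))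
    (hcdep : ∀ j i, j + 1 ≤ i → ∀ (x : (i : ℕ) → S i → V) (y : S i → V), c j (update x i y) = c j x)
    {r : ℕ → ℝ} (hr : ∀ j, 4 * (Module.finrank ℝ V : ℝ) * Real.log 2 ≤ a * r j)
    {Z : ℝ} (hZ : 0 ≤ Z) {X : (S 0 → V) → ℝ} (hX : Measurable X)
    {Bnd : Type*} (Bk : ℕ → Finset Bnd) (t : ℕ → Bnd → (S 0 → V) → ℝ)
    (ht : ∀ j, ∀ bb ∈ Bk j, ∀ u, 0 ≤ t j bb u) {M : ℕ → (S 0 → V) → ℝ} (hM : ∀ j u, 0 ≤ M j u)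
    (E : ℕ → ℝ) {γ₀ : ℝ} (hγ : 0 ≤ γ₀)
    {b : ((i : ℕ) → S i → V) → ℝ} (hb : ∀ x, 0 ≤ b x ∧ b x ≤ 1)
    (h326 : ∀ x, b x ≠ 0 →
      (∑ j ∈ range (K + 1), (γ₀ * (∑ bb ∈ Bk j, t j bb (x 0) + M j (x 0)) - E j)) ≤ X (x 0))
    (w : (j : Fin K) → ι j → ℝ≥0∞) (Q : (j : Fin K) → ι j → Finset Bnd) (hQ : ∀ j τ, Q j τ ⊆ Bk j)
    (P : (j : Fin K) → ι j → Finset (S (j + 1)))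
    (χQ : (j : Fin K) → ι j → (S 0 → V) → ℝ) (hχ : ∀ j τ u, χQ j τ u = 0 ∨ χQ j τ u = 1)
    (hlarge : ∀ j τ u, χQ j τ u = 1 → ∀ bb ∈ Q j τ, r j < t j bb u)
    (x : (i : ℕ) → S i → V) :
    rhs322 (fun i => (volume : Measure (S i → V)))
        (fun u => ENNReal.ofReal (Z * Real.exp (-(X u / 2)))) (fun x => ENNReal.ofReal (b x))
        (gaussLevel (fun j _ => a * s j) c) w (fun j τ u => ENNReal.ofReal (χQ j τ u))
        (fun j τ => excLevel c j (largeFieldSite (P j τ) (s j) (r j))) x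
      ≤ ENNReal.ofReal (Real.exp ((∑ j ∈ range (K + 1), E j) / 4))
        * (∫⁻ u, ENNReal.ofReal (Z * Real.exp (-(X u / 4))))
        * ∏ j : Fin K, ∑ τ : ι j, w j τ * ENNReal.ofReal (Real.exp (-(γ₀ * r j * (Q j τ).card / 4)))
            * ENNReal.ofReal (Real.exp (-(a * r j / 8)) ^ (P j τ).card) := by
  refine rhs322_le (μ := fun i => (volume : Measure (S i → V)))
    (F := fun u => ENNReal.ofReal (Z * Real.exp (-(X u / 2))))
    (σ := fun j τ => ENNReal.ofReal (Real.exp (-(γ₀ * r j * (Q j τ).card / 4))))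
    (θ := fun j τ => ENNReal.ofReal (Real.exp (-(a * r j / 8)) ^ (P j τ).card))
    ?_ (measurable_gaussLevel hc) (gaussLevel_update_of_lt hcdep) ?_ ?_ ?_ ?_ x
  · -- measurability of F₄
    exact ENNReal.measurable_ofReal.comp (measurable_const.mul ((hX.div_const 4).neg.exp))
  · -- measurability of the exception factors
    exact fun j τ => measurable_excLevel hc j fun y => measurable_largeFieldSite (P j τ) (s j) (r j) y
  · -- locality of the exception factors
    exact fun j τ i hji x y => excLevel_update_of_lt hcdep j _ i hji x y
  · -- (3.32)/(3.33): the exceptional masses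
    exact fun j τ x => lintegral_gaussLevel_mul_excLevel_printed_le ha hs hcdep hr j (P j τ) x
  · -- (3.26)/(3.30)/(3.31): the pointwise step
    intro τ x
    exact pointwise335 Bk (fun j bb => t j bb (x 0)) (fun j bb hbb => ht j bb hbb (x 0))
      (M := fun j => M j (x 0)) E (fun j => hM j (x 0)) hγ r (fun j => Q j (τ j)) (fun j => hQ j (τ j)) (fun j => χQ j (τ j) (x 0))
      (fun j => hχ j (τ j) (x 0)) (fun j => hlarge j (τ j) (x 0)) hZ (hb x) (h326 x)

end Printed

end Literature.MathematicalPhysics.QuantumFieldTheory.Balaban1983to89.B2Ineq335Printed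

end
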